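import Summits.ValiantsHypothesis.ValiantsHypothesis.Theorems.DefinabilityGapQuadraticReading
import HarnessLib

/-!
# DefinabilityGap — alien-multiset exclusion: a star-free pattern choice certifies hitting (unconditional)

Route `route-ValiantsHypothesis-DefinabilityGap` (decomp-valiant, lens 5: hardness–randomness / PIT axis), supporting the
hitting residual `KIPlantedHitting` (stmt-ValiantsHypothesis-23547) and the degree profile behind `KIAnnihilatorCHDefinable`
(stmt-ValiantsHypothesis-23444). Source: decomp-valiant lens-5 g16, NOTE-g16 §3 (Lemmas 1–2 of "Theorem A").

THE MECHANISM. For a monomial `z^κ₀` of `D` and one permutation pattern `π_b` per block `b`, form the witness exponent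
`W = Σ_b κ₀(b) · μ(b, π_b)`. The coefficient of `y^W` in `D ∘ G_m` is `Σ_κ coeff_κ(D) · N(κ, W)` where `N(κ, W)` counts the
READINGS of `W` by `κ` (`coeff_readingExp_bind₁`); `N(κ₀, W) ≥ 1`. Readings by the SAME multiset need not be unique — only
ALIEN multisets `κ ≠ κ₀` must be excluded, and an alien reading forces a STAR (`star_of_reading`): a block `d` and, in every
column `a`, a block `b ≠ d` of `κ₀` whose pattern cell in column `a` is shared with `d`. Hence (`kiPer_hits_of_starFree`):
if some pattern choice is star-free for some monomial of `D`, then `D ∘ G_m ≠ 0` — whatever the degree or size of `D`.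
Since two blocks share `≤ 2` cells, a star needs `≥ m/2` blocks (`two_mul_card_support_ge_of_star`), which re-proves the
low-degree rung; random patterns are star-free up to degree `≍ m²` (NOTE-g16 §3.4, the counting half, not in this file).
0 sorry; VP ≠ VNP untouched.
-/

set_option linter.dupNamespace false

noncomputable section

open MvPolynomial
open Literature.Computability.AlgebraicComplexity Literature.Computability.MetaComplexity
open Summit.ValiantsHypothesis.ValiantsHypothesis.Theorems.DefinabilityGapAffineRung

namespace Summit.ValiantsHypothesis.ValiantsHypothesis.Theorems.DefinabilityGapAlienExclusion

variable {m : ℕ}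

/-! ## 1. `G_m(b)` as a sum of pattern monomials; readings -/

/-- `G_m(b) = Σ_ρ y^{μ(b,ρ)}`. [folklore] -/
theorem kiPer_eq_sum_pmono (b : Fin 3 → Fin (qOf m)) :
    kiPer m b = ∑ ρ : Equiv.Perm (Fin m), monomial (pmono m b ρ) 1 := by
  rw [kiPer_eq_rename_cellEmb, perPoly_eq_sum_monomial, map_sum]
  refine Finset.sum_congr rfl fun ρ _ => ?_
  rw [rename_monomial]
  rfl

/-- A reading of an exponent by the multiset `κ`: `κ(b)` patterns for each block `b`. [this file] -/
abbrev Reading (m : ℕ) (κ : (Fin 3 → Fin (qOf m)) →₀ ℕ) : Type :=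
  (b : Fin 3 → Fin (qOf m)) → Fin (κ b) → Equiv.Perm (Fin m)

/-- The exponent read: `Σ_b Σ_{i < κ b} μ(b, P b i)`. [this file] -/
def readingExp (κ : (Fin 3 → Fin (qOf m)) →₀ ℕ) (P : Reading m κ) : (Fin (qOf m) × Fin (qOf m)) →₀ ℕ :=
  ∑ b, ∑ i, pmono m b (P b i)

/-- The number `N(κ, W)` of readings of `W` by `κ`. [this file] -/
def numReadings (κ : (Fin 3 → Fin (qOf m)) →₀ ℕ) (W : (Fin (qOf m) × Fin (qOf m)) →₀ ℕ) : ℕ := by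
  classical
  exact (Finset.univ.filter fun P : Reading m κ => readingExp κ P = W).card

/-- `∏_b G_m(b)^{κ b} = Σ_P y^{readingExp κ P}`. [this file] -/
theorem prod_pow_kiPer_eq (κ : (Fin 3 → Fin (qOf m)) →₀ ℕ) :
    ∏ b, kiPer m b ^ κ b = ∑ P : Reading m κ, monomial (readingExp κ P) (1 : ℂ) := by
  classical
  have hb : ∀ b : Fin 3 → Fin (qOf m), kiPer m b ^ κ b =
      ∑ p : Fin (κ b) → Equiv.Perm (Fin m), monomial (∑ i, pmono m b (p i)) (1 : ℂ) := by
    intro b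
    have h1 : kiPer m b ^ κ b = ∏ _i : Fin (κ b), ∑ ρ : Equiv.Perm (Fin m), monomial (pmono m b ρ) (1 : ℂ) := by
      rw [Finset.prod_const, Finset.card_univ, Fintype.card_fin, kiPer_eq_sum_pmono]
    rw [h1, Finset.prod_univ_sum, Fintype.piFinset_univ]
    refine Finset.sum_congr rfl fun p _ => ?_
    rw [monomial_sum_one]
  simp_rw [hb]
  rw [Finset.prod_univ_sum, Fintype.piFinset_univ]
  refine Finset.sum_congr rfl fun P _ => ?_
  rw [readingExp, monomial_sum_one]

/-- `coeff_W (∏_b G_m(b)^{κ b}) = N(κ, W)`. [this file] -/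
theorem coeff_prod_pow_kiPer (κ : (Fin 3 → Fin (qOf m)) →₀ ℕ) (W : (Fin (qOf m) × Fin (qOf m)) →₀ ℕ) :
    coeff W (∏ b, kiPer m b ^ κ b) = (numReadings κ W : ℂ) := by
  classical
  rw [prod_pow_kiPer_eq, coeff_sum]
  simp only [coeff_monomial, Finset.sum_boole, numReadings]

/-- **Reading expansion of `D ∘ G_m`**: `coeff_W (D ∘ G_m) = Σ_{κ ∈ supp D} coeff_κ(D) · N(κ, W)`. [this file] -/
theorem coeff_bind₁_kiPer (D : MvPolynomial (Fin 3 → Fin (qOf m)) ℂ) (W : (Fin (qOf m) × Fin (qOf m)) →₀ ℕ) :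
    coeff W (bind₁ (kiPer m) D) = ∑ κ ∈ D.support, coeff κ D * (numReadings κ W : ℂ) := by
  classical
  conv_lhs => rw [D.as_sum, map_sum]
  rw [coeff_sum]
  refine Finset.sum_congr rfl fun κ _ => ?_
  have hprod : ∏ b ∈ κ.support, kiPer m b ^ κ b = ∏ b, kiPer m b ^ κ b := by
    refine Finset.prod_subset (Finset.subset_univ _) fun b _ hb => ?_
    rw [Finsupp.notMem_support_iff.1 hb, pow_zero]
  rw [bind₁_monomial, hprod, coeff_C_mul, coeff_prod_pow_kiPer]

/-! ## 2. The witness exponent and its planted reading -/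

/-- The witness exponent `W(κ₀, π) = Σ_b κ₀(b) · μ(b, π b)`. [this file] -/
def witnessExp (κ₀ : (Fin 3 → Fin (qOf m)) →₀ ℕ) (π : (Fin 3 → Fin (qOf m)) → Equiv.Perm (Fin m)) :
    (Fin (qOf m) × Fin (qOf m)) →₀ ℕ :=
  ∑ b, κ₀ b • pmono m b (π b)

/-- The planted reading (every factor of block `b` uses `π b`) reads `W(κ₀, π)`. [this file] -/
theorem readingExp_planted (κ₀ : (Fin 3 → Fin (qOf m)) →₀ ℕ) (π : (Fin 3 → Fin (qOf m)) → Equiv.Perm (Fin m)) :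
    readingExp κ₀ (fun b _ => π b) = witnessExp κ₀ π := by
  unfold readingExp witnessExp
  refine Finset.sum_congr rfl fun b _ => ?_
  rw [Finset.sum_const, Finset.card_univ, Fintype.card_fin]

/-- `N(κ₀, W(κ₀, π)) ≥ 1`. [this file] -/
theorem numReadings_witnessExp_pos (κ₀ : (Fin 3 → Fin (qOf m)) →₀ ℕ) (π : (Fin 3 → Fin (qOf m)) → Equiv.Perm (Fin m)) :
    0 < numReadings κ₀ (witnessExp κ₀ π) := by
  classical
  unfold numReadings
  exact Finset.card_pos.2 ⟨fun b _ => π b, by simp [readingExp_planted]⟩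

/-! ## 3. Degrees: a reading by `κ` has degree `m · |κ|` -/

/-- `deg (readingExp κ P) = m · Σ_b κ b`. [this file] -/
theorem degree_readingExp (κ : (Fin 3 → Fin (qOf m)) →₀ ℕ) (P : Reading m κ) :
    (readingExp κ P).degree = m * ∑ b, κ b := by
  unfold readingExp
  rw [map_sum, Finset.mul_sum]
  refine Finset.sum_congr rfl fun b _ => ?_
  rw [map_sum]
  simp [degree_pmono, mul_comm]

/-- A reading of `W(κ₀, π)` by `κ` forces `Σ κ = Σ κ₀` (when `m ≥ 1`). [this file] -/
theorem sum_eq_of_readingExp_eq (hm : 0 < m) {κ κ₀ : (Fin 3 → Fin (qOf m)) →₀ ℕ} {P : Reading m κ}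
    {π : (Fin 3 → Fin (qOf m)) → Equiv.Perm (Fin m)} (h : readingExp κ P = witnessExp κ₀ π) :
    ∑ b, κ b = ∑ b, κ₀ b := by
  have h1 := congrArg Finsupp.degree h
  rw [← readingExp_planted, degree_readingExp, degree_readingExp] at h1
  exact Nat.eq_of_mul_eq_mul_left hm h1

/-- Two distinct multisets of the same size: one block is over-represented in the second. [folklore] -/
theorem exists_lt_of_ne_of_sum_eq {κ κ₀ : (Fin 3 → Fin (qOf m)) →₀ ℕ} (hne : κ ≠ κ₀)
    (hsum : ∑ b, κ b = ∑ b, κ₀ b) : ∃ c, κ₀ c < κ c := by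
  by_contra h
  push Not at h
  have hle : ∀ b ∈ (Finset.univ : Finset (Fin 3 → Fin (qOf m))), κ b ≤ κ₀ b := fun b _ => h b
  have heq := (Finset.sum_eq_sum_iff_of_le hle).1 hsum
  exact hne (Finsupp.ext fun b => heq b (Finset.mem_univ b))

/-! ## 4. The column functional and the star lemma -/

/-- `Φ_{c,a}(u)`: the total exponent of `u` on the cells of block `c` in column `a`. [this file] -/
def colWeight (c : Fin 3 → Fin (qOf m)) (a : Fin m) (u : (Fin (qOf m) × Fin (qOf m)) →₀ ℕ) : ℕ :=
  ∑ r : Fin m, u (cellEmb m c (r, a))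

/-- `Φ_{c,a}` is additive. [this file] -/
theorem colWeight_add (c : Fin 3 → Fin (qOf m)) (a : Fin m) (u v : (Fin (qOf m) × Fin (qOf m)) →₀ ℕ) :
    colWeight c a (u + v) = colWeight c a u + colWeight c a v := by
  simp [colWeight, Finset.sum_add_distrib]

/-- `Φ_{c,a}` of a finite sum. [this file] -/
theorem colWeight_sum {ι : Type*} (c : Fin 3 → Fin (qOf m)) (a : Fin m) (s : Finset ι)
    (g : ι → (Fin (qOf m) × Fin (qOf m)) →₀ ℕ) :
    colWeight c a (∑ i ∈ s, g i) = ∑ i ∈ s, colWeight c a (g i) := by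
  classical
  induction s using Finset.induction_on with
  | empty => simp [colWeight]
  | insert i s hi ih => rw [Finset.sum_insert hi, Finset.sum_insert hi, colWeight_add, ih]

/-- `Φ_{c,a}` of a multiple. [this file] -/
theorem colWeight_nsmul (c : Fin 3 → Fin (qOf m)) (a : Fin m) (k : ℕ) (u : (Fin (qOf m) × Fin (qOf m)) →₀ ℕ) :
    colWeight c a (k • u) = k * colWeight c a u := by
  simp [colWeight, Finset.mul_sum]

/-- Values of a pattern monomial at the cells of its own block: `μ(c,ρ)(E_c(r,a)) = [ρ a = r]`. [this file] -/
theorem pmono_apply_cellEmb_self (c : Fin 3 → Fin (qOf m)) (ρ : Equiv.Perm (Fin m)) (r a : Fin m) :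
    pmono m c ρ (cellEmb m c (r, a)) = if ρ a = r then 1 else 0 := by
  rw [pmono, Finsupp.mapDomain_apply (cellEmb m c).injective, permMonomial_apply]

/-- `Φ_{c,a}(μ(c, ρ)) = 1`. [this file] -/
theorem colWeight_pmono_self (c : Fin 3 → Fin (qOf m)) (a : Fin m) (ρ : Equiv.Perm (Fin m)) :
    colWeight c a (pmono m c ρ) = 1 := by
  simp [colWeight, pmono_apply_cellEmb_self]

/-- If `μ(b, σ)` is nonzero at the cell `E_c(r, a)` then `r = σ a` and the column-`a` cell of `σ` is shared by `b` and `c`.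
[this file] -/
theorem share_of_pmono_apply_ne_zero {b c : Fin 3 → Fin (qOf m)} {σ : Equiv.Perm (Fin m)} {r a : Fin m}
    (h : pmono m b σ (cellEmb m c (r, a)) ≠ 0) : r = σ a ∧ cellEmb m b (σ a, a) = cellEmb m c (σ a, a) := by
  have hmem : cellEmb m c (r, a) ∈ (pmono m b σ).support := Finsupp.mem_support_iff.2 h
  obtain ⟨a', ha'⟩ := mem_support_pmono.1 hmem
  have hpos := pos_eq_of_cellEmb_eq ha'
  obtain ⟨rfl, rfl⟩ := Prod.mk.inj hpos
  exact ⟨rfl, ha'.symm⟩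

/-- `Φ_{c,a}(μ(b, σ)) = 0` unless the column-`a` cell of `σ` is shared by `b` and `c`. [this file] -/
theorem colWeight_pmono_eq_zero {b c : Fin 3 → Fin (qOf m)} {σ : Equiv.Perm (Fin m)} {a : Fin m}
    (h : cellEmb m b (σ a, a) ≠ cellEmb m c (σ a, a)) : colWeight c a (pmono m b σ) = 0 := by
  refine Finset.sum_eq_zero fun r _ => ?_
  by_contra hr
  exact h (share_of_pmono_apply_ne_zero hr).2

/-! A STAR of the pattern choice `π` for the multiset `κ₀` is a block `d` together with, in every column `a`, a block
`b ≠ d` of `κ₀` whose column-`a` pattern cell is shared with `d`: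
`∃ d, ∀ a, ∃ b, b ≠ d ∧ κ₀ b ≠ 0 ∧ cellEmb m b (π b a, a) = cellEmb m d (π b a, a)`.
STAR-FREE is its negation, spelled out positively in the statements below. -/

/-- **Star lemma.** If a multiset `κ` with `κ c > κ₀ c` reads the witness exponent `W(κ₀, π)`, then in every column some
block `b ≠ c` of `κ₀` shares its pattern cell with `c`. [this file] -/
theorem share_of_reading {κ κ₀ : (Fin 3 → Fin (qOf m)) →₀ ℕ} {c : Fin 3 → Fin (qOf m)} (hlt : κ₀ c < κ c)
    {P : Reading m κ} {π : (Fin 3 → Fin (qOf m)) → Equiv.Perm (Fin m)}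
    (h : readingExp κ P = witnessExp κ₀ π) (a : Fin m) :
    ∃ b, b ≠ c ∧ κ₀ b ≠ 0 ∧ cellEmb m b (π b a, a) = cellEmb m c (π b a, a) := by
  classical
  by_contra hno
  push Not at hno
  -- Φ of the reading side is ≥ κ c
  have hlow : κ c ≤ colWeight c a (readingExp κ P) := by
    unfold readingExp
    rw [colWeight_sum]
    have hc : colWeight c a (∑ i, pmono m c (P c i)) = κ c := by
      rw [colWeight_sum]
      simp [colWeight_pmono_self]
    rw [← hc]
    exact Finset.single_le_sum (f := fun b => colWeight c a (∑ i, pmono m b (P b i)))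
      (fun b _ => Nat.zero_le _) (Finset.mem_univ c)
  -- Φ of the witness side is κ₀ c
  have hup : colWeight c a (witnessExp κ₀ π) = κ₀ c := by
    unfold witnessExp
    rw [colWeight_sum, Finset.sum_eq_single c]
    · rw [colWeight_nsmul, colWeight_pmono_self, mul_one]
    · intro b _ hbc
      rw [colWeight_nsmul]
      by_cases hb : κ₀ b = 0
      · rw [hb, zero_mul]
      · rw [colWeight_pmono_eq_zero (hno b hbc hb), mul_zero]
    · intro hc; exact absurd (Finset.mem_univ c) hc
  rw [h, hup] at hlow
  omega

/-- An alien multiset reading the witness exponent produces a star. [this file] -/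
theorem star_of_reading (hm : 0 < m) {κ κ₀ : (Fin 3 → Fin (qOf m)) →₀ ℕ} (hne : κ ≠ κ₀)
    {P : Reading m κ} {π : (Fin 3 → Fin (qOf m)) → Equiv.Perm (Fin m)}
    (h : readingExp κ P = witnessExp κ₀ π) :
    ∃ d : Fin 3 → Fin (qOf m), ∀ a : Fin m, ∃ b : Fin 3 → Fin (qOf m),
      b ≠ d ∧ κ₀ b ≠ 0 ∧ cellEmb m b (π b a, a) = cellEmb m d (π b a, a) := by
  obtain ⟨c, hc⟩ := exists_lt_of_ne_of_sum_eq hne (sum_eq_of_readingExp_eq hm h)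
  exact ⟨c, fun a => share_of_reading hc h a⟩

/-! ## 5. Star-free patterns certify hitting -/

/-- **Alien-multiset exclusion.** If, for some monomial `z^κ₀` of `D`, some choice of one permutation pattern per block is
star-free, then `D ∘ G_m ≠ 0`: the coefficient of the witness monomial is `coeff_κ₀(D) · N(κ₀, W) ≠ 0`. No hypothesis on the
degree or the size of `D`. [this file] -/
theorem kiPer_hits_of_starFree (D : MvPolynomial (Fin 3 → Fin (qOf m)) ℂ) {κ₀ : (Fin 3 → Fin (qOf m)) →₀ ℕ}
    (hκ₀ : κ₀ ∈ D.support) {π : (Fin 3 → Fin (qOf m)) → Equiv.Perm (Fin m)}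
    (hπ : ∀ d : Fin 3 → Fin (qOf m), ∃ a : Fin m, ∀ b : Fin 3 → Fin (qOf m),
      b ≠ d → κ₀ b ≠ 0 → cellEmb m b (π b a, a) ≠ cellEmb m d (π b a, a)) :
    MvPolynomial.bind₁ (kiPer m) D ≠ 0 := by
  classical
  have hm : 0 < m := by
    obtain ⟨a, -⟩ := hπ fun _ => ⟨0, (qOf_spec m).2.pos⟩
    exact Fin.pos a
  intro hzero
  have hcoeff := coeff_bind₁_kiPer D (witnessExp κ₀ π)
  rw [hzero, coeff_zero, Finset.sum_eq_single_of_mem κ₀ hκ₀] at hcoeff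
  · have h1 : coeff κ₀ D ≠ 0 := mem_support_iff.1 hκ₀
    have h2 : (numReadings κ₀ (witnessExp κ₀ π) : ℂ) ≠ 0 :=
      Nat.cast_ne_zero.2 (numReadings_witnessExp_pos κ₀ π).ne'
    exact mul_ne_zero h1 h2 hcoeff.symm
  · intro κ _ hne
    suffices hN : numReadings κ (witnessExp κ₀ π) = 0 by rw [hN, Nat.cast_zero, mul_zero]
    unfold numReadings
    rw [Finset.card_eq_zero, Finset.filter_eq_empty_iff]
    intro P _ hP
    obtain ⟨d, hd⟩ := star_of_reading hm hne hP
    obtain ⟨a, ha⟩ := hπ d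
    obtain ⟨b, hbd, hb0, hcell⟩ := hd a
    exact ha b hbd hb0 hcell

/-! ## 6. A star needs `≥ m/2` blocks (two quadratic curves share `≤ 2` cells) -/

/-- The matrix positions at which blocks `b ≠ d` have the same seed cell: at most `2`. [this file] -/
theorem card_sharedPos_le_two {b d : Fin 3 → Fin (qOf m)} (hbd : b ≠ d) :
    (Finset.univ.filter fun x : Fin m × Fin m => cellEmb m b x = cellEmb m d x).card ≤ 2 := by
  classical
  have hsub : (Finset.univ.filter fun x : Fin m × Fin m => cellEmb m b x = cellEmb m d x).map (cellEmb m b) ⊆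
      Finset.univ.map (quadDesign m b) ∩ Finset.univ.map (quadDesign m d) := by
    intro s hs
    obtain ⟨x, hx, rfl⟩ := Finset.mem_map.1 hs
    have hx' := (Finset.mem_filter.1 hx).2
    refine Finset.mem_inter.2 ⟨?_, ?_⟩
    · exact Finset.mem_map.2 ⟨permPad (sq_le_qOf m) x, Finset.mem_univ _, rfl⟩
    · rw [hx']
      exact Finset.mem_map.2 ⟨permPad (sq_le_qOf m) x, Finset.mem_univ _, rfl⟩
  have h := (Finset.card_le_card hsub).trans (quadDesign_isNWDesign m hbd)
  rwa [Finset.card_map] at h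

/-- **A star needs at least `m/2` blocks of `κ₀`.** Consequently for `2·|supp κ₀| < m` EVERY pattern choice is star-free
and `kiPer_hits_of_starFree` re-proves the low-degree rung. [this file] -/
theorem two_mul_card_support_ge_of_star {κ₀ : (Fin 3 → Fin (qOf m)) →₀ ℕ}
    {π : (Fin 3 → Fin (qOf m)) → Equiv.Perm (Fin m)} {d : Fin 3 → Fin (qOf m)}
    (hd : ∀ a : Fin m, ∃ b : Fin 3 → Fin (qOf m), b ≠ d ∧ κ₀ b ≠ 0 ∧ cellEmb m b (π b a, a) = cellEmb m d (π b a, a)) :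
    m ≤ 2 * κ₀.support.card := by
  classical
  choose f hf using hd
  -- every block of `κ₀` other than `d` serves at most two columns
  have hfib : ∀ b ∈ κ₀.support, (Finset.univ.filter fun a : Fin m => f a = b).card ≤ 2 := by
    intro b _
    by_cases hbd : b = d
    · have : (Finset.univ.filter fun a : Fin m => f a = b) = ∅ := by
        rw [Finset.filter_eq_empty_iff]
        intro a _ hab
        exact (hf a).1 (hab.trans hbd)
      rw [this]; simp
    · have hinj : ((Finset.univ.filter fun a : Fin m => f a = b).map
          ⟨fun a : Fin m => ((π b a, a) : Fin m × Fin m), fun a a' h => (Prod.mk.inj h).2⟩) ⊆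
          Finset.univ.filter fun x : Fin m × Fin m => cellEmb m b x = cellEmb m d x := by
        intro x hx
        obtain ⟨a, ha, rfl⟩ := Finset.mem_map.1 hx
        have hab : f a = b := (Finset.mem_filter.1 ha).2
        refine Finset.mem_filter.2 ⟨Finset.mem_univ _, ?_⟩
        have := (hf a).2.2
        rw [hab] at this
        exact this
      have := (Finset.card_le_card hinj).trans (card_sharedPos_le_two hbd)
      rwa [Finset.card_map] at this
  have hmaps : ∀ a ∈ (Finset.univ : Finset (Fin m)), f a ∈ κ₀.support :=
    fun a _ => Finsupp.mem_support_iff.2 (hf a).2.1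
  have hcount := Finset.card_eq_sum_card_fiberwise hmaps
  rw [Finset.card_univ, Fintype.card_fin] at hcount
  have hsum := Finset.sum_le_card_nsmul _ _ 2 hfib
  rw [← hcount, smul_eq_mul, mul_comm] at hsum
  exact hsum

/-- The low-degree rung re-proved through star-freeness: `2·|supp κ₀| < m` for a monomial `z^κ₀` of `D` forces
`D ∘ G_m ≠ 0` (in particular for `deg D < m/2`, cf. `kiPer_hits_lowDegree`). [this file] -/
theorem kiPer_hits_of_small_support (D : MvPolynomial (Fin 3 → Fin (qOf m)) ℂ) {κ₀ : (Fin 3 → Fin (qOf m)) →₀ ℕ}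
    (hκ₀ : κ₀ ∈ D.support) (hsmall : 2 * κ₀.support.card < m) : MvPolynomial.bind₁ (kiPer m) D ≠ 0 := by
  refine kiPer_hits_of_starFree D hκ₀ (π := fun _ => 1) fun d => ?_
  by_contra hno
  push Not at hno
  choose g hg using hno
  have hle := two_mul_card_support_ge_of_star (κ₀ := κ₀) (π := fun _ => 1) (d := d)
    fun a => ⟨g a, (hg a).1, (hg a).2.1, (hg a).2.2⟩
  omega

end Summit.ValiantsHypothesis.ValiantsHypothesis.Theorems.DefinabilityGapAlienExclusion
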